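import Literature.RingTheory.MvPolynomial.TwoPointLineChains
import Literature.FieldTheory.QuasiAlgClosed.TsenSystems
import Mathlib.RingTheory.AlgebraicIndependent.Adjoin
import Mathlib.RingTheory.AlgebraicIndependent.TranscendenceBasis
import HarnessLib

/-!
# Two-point line chains over `C_r` fields; the function field of a surface is `C₂` for systems

Two algebraic inputs of the product-trick argument for `2`-cycles (the dimension-two base):

* `IsCrSystem.of_trdeg_eq_two` — **Tsen–Lang, transcendence degree two**: if `K` has Pfister's
  systems property `C_i` and `trdeg_K L = 2`, then `L` has the systems property `C_{i+2}` (Pfister,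
  *Quadratic Forms with Applications to Algebraic Geometry and Topology*, Ch. 5 Cor. 1.5 with
  `j = 2`: `L` is algebraic over `K(Y₁, Y₂) ≅ Frac K[Y₁, Y₂]`, and Thms. 1.3, 1.4); in particular
  the function field of a surface over an algebraically closed field is `C₂` for systems
  (`isCrSystem_two_of_trdeg_eq_two`);
* `exists_two_line_chain_of_isCrSystem` — the two-point line chain of
  `Literature.RingTheory.MvPolynomial.exists_two_line_chain` (Tian–Zong, proof of Prop. 7.2: for
  zeros `p, q` of forms `F_a` a vector `r` with `F_a` vanishing on `span(p, r)` and `span(q, r)`)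
  under the solver `IsCrSystem r K` with the degree count `Σ_j e_j^r < N + 1` (`e` the degrees
  `1, …, d_a - 1` twice and `d_a`); for one cubic form and `r = 2` the count is
  `1 + 4 + 1 + 4 + 9 = 19 < N + 1`.

Everything is proved; no definitions. [folklore]

## References

* [Pfister1995] A. Pfister, *Quadratic Forms with Applications to Algebraic Geometry and Topology*,
  LMS Lecture Notes 217 (1995), Ch. 5, Thms. 1.3, 1.4, Cor. 1.5.
* [TianZong2014] Z. Tian, H. R. Zong, *One-cycles on rationally connected varieties*, Compositio
  Math. 150 (2014), proof of Prop. 7.2.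
-/

noncomputable section

open MvPolynomial Literature.FieldTheory.QuasiAlgClosed

universe u v

/-! ### `C_{i+2}` for extensions of transcendence degree two -/

namespace Literature.FieldTheory.QuasiAlgClosed

/-- `K[Y₁, Y₂]` (two variables) has the systems property `C_{i+2}` if `K` has `C_i`: two
applications of Thm. 1.3 (`IsCrSystem.polynomial`) along `K[Y₁, Y₂] ≅ K[Y₁][Y₂]`.
[cite: Pfister1995, Ch. 5 Thm. 1.3] -/
theorem IsCrSystem.mvPolynomial_fin_two {i : ℕ} {K : Type u} [Field K] (hK : IsCrSystem i K) :
    IsCrSystem (i + 2) (MvPolynomial (Fin 2) K) := by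
  -- `K[Y₁][Y₂]`: Thm. 1.3 twice (the tree's `IsCrSystem.polynomial` is stated over any ring)
  have h2 : IsCrSystem (i + 1 + 1) (Polynomial (Polynomial K)) := hK.polynomial.polynomial
  -- `K[Y₁] ≅ K[x₀]` (one variable) and `K[x₀][Y₂] ≅ K[x₀, x₁]`
  have e1 : Polynomial K ≃+* MvPolynomial (Fin 1) K :=
    ((MvPolynomial.finSuccEquiv K 0).toRingEquiv.trans
      (Polynomial.mapEquiv (MvPolynomial.isEmptyAlgEquiv K (Fin 0)).toRingEquiv)).symm
  have h2' : IsCrSystem (i + 1 + 1) (Polynomial (MvPolynomial (Fin 1) K)) :=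
    h2.of_ringEquiv (Polynomial.mapEquiv e1)
  exact h2'.of_ringEquiv (MvPolynomial.finSuccEquiv K 1).toRingEquiv.symm

/-- **Cor. 1.5, transcendence degree two**: if `K` has the systems property `C_i` and `L ⊇ K` has
transcendence degree `2`, then `L` has the systems property `C_{i+2}` (`L` is algebraic over
`K(Y₁, Y₂)`, which is the fraction field of `K[Y₁, Y₂]`). [cite: Pfister1995, Ch. 5 Cor. 1.5] -/
theorem IsCrSystem.of_trdeg_eq_two {i : ℕ} {K L : Type u} [Field K] [Field L] [Algebra K L]
    (hK : IsCrSystem i K) (hL : Algebra.trdeg K L = 2) : IsCrSystem (i + 2) L := by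
  obtain ⟨ι, x, hx⟩ : ∃ (ι : Type u) (x : ι → L), IsTranscendenceBasis K x :=
    exists_isTranscendenceBasis' K L
  have hι : Cardinal.mk ι = 2 := by
    have h := hx.lift_cardinalMk_eq_trdeg
    rw [hL] at h
    simpa using h
  -- reindex the basis by `Fin 2`
  have hιfin : Cardinal.mk ι = Cardinal.mk (ULift.{u} (Fin 2)) := by rw [hι]; simp
  obtain ⟨e⟩ := Cardinal.eq.1 hιfin
  let e' : Fin 2 ≃ ι := Equiv.ulift.symm.trans e.symm
  have hx' : IsTranscendenceBasis K (x ∘ e') := hx.comp_equiv e'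
  haveI : Algebra.IsAlgebraic (IntermediateField.adjoin K (Set.range (x ∘ e'))) L :=
    hx'.isAlgebraic_field
  have hC : IsCrSystem (i + 2) (IntermediateField.adjoin K (Set.range (x ∘ e'))) := by
    have hfrac : IsCrSystem (i + 2) (FractionRing (MvPolynomial (Fin 2) K)) :=
      hK.mvPolynomial_fin_two.of_isFractionRing
    exact hfrac.of_ringEquiv (hx'.1.aevalEquivField).toRingEquiv
  exact hC.of_isAlgebraic

/-- **Tsen–Lang for systems, transcendence degree two**: a field of transcendence degree two over an
algebraically closed field (the function field of a surface) has Pfister's systems property `C₂`.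
[cite: Pfister1995, Ch. 5 Cor. 1.5 and Prop. 1.2 (2)] -/
theorem isCrSystem_two_of_trdeg_eq_two {k₀ K : Type u} [Field k₀] [IsAlgClosed k₀] [Field K]
    [Algebra k₀ K] (hK : Algebra.trdeg k₀ K = 2) : IsCrSystem 2 K :=
  (isCrSystem_zero_of_isAlgClosed k₀).of_trdeg_eq_two hK

end Literature.FieldTheory.QuasiAlgClosed

/-! ### The two-point line chain under a `C_r` solver -/

namespace Literature.RingTheory.MvPolynomial

variable {K : Type u} [Field K] {N : ℕ}

/-- **Two zeros of a system of forms are joined by two lines of zeros through a common point, over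
a `C_r` field** — `exists_two_line_chain` with the solver `IsCrSystem r K` and the degree count
`Σ_a (2 Σ_{e=1}^{d_a-1} e^r + d_a^r) < N + 1` made explicit as the hypothesis on the system's
degrees: the conditions are the `s^e`-coefficients (`1 ≤ e ≤ d_a - 1`) of `F_a(s p + y)` and of
`F_a(s q + y)`, of degrees `d_a - e`, and `F_a` itself. [cite: TianZong2014, proof of Prop. 7.2] -/
theorem exists_two_line_chain_of_isCrSystem {r : ℕ} (hK : IsCrSystem r K)
    {c : ℕ} {F : Fin c → MvPolynomial (Fin (N + 1)) K} {d : Fin c → ℕ}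
    (hF : ∀ a, (F a).IsHomogeneous (d a)) (hd : ∀ a, 0 < d a)
    (hN : ∑ a, (2 * ∑ i : Fin (d a - 1), (d a - 1 - (i : ℕ)) ^ r + d a ^ r) < N + 1)
    {p q : Fin (N + 1) → K} (hp : ∀ a, eval p (F a) = 0) (hq : ∀ a, eval q (F a) = 0) :
    ∃ rv : Fin (N + 1) → K, rv ≠ 0 ∧ ∀ a (s t : K),
      eval (s • p + t • rv) (F a) = 0 ∧ eval (s • q + t • rv) (F a) = 0 := by
  classical
  -- the system: `s^{e+1}`-coefficients through `p` and through `q`, `e < d_a - 1`, and `F_a`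
  let J : Type := ((Σ a : Fin c, Fin (d a - 1)) ⊕ (Σ a : Fin c, Fin (d a - 1))) ⊕ Fin c
  let g : J → MvPolynomial (Fin (N + 1)) K :=
    Sum.elim (Sum.elim
      (fun x => coeff (Finsupp.single 0 ((x.2 : ℕ) + 1)) (linePoly p (F x.1)))
      (fun x => coeff (Finsupp.single 0 ((x.2 : ℕ) + 1)) (linePoly q (F x.1))))
      (fun a => F a)
  let e : J → ℕ :=
    Sum.elim (Sum.elim (fun x => d x.1 - 1 - (x.2 : ℕ)) (fun x => d x.1 - 1 - (x.2 : ℕ)))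
      (fun a => d a)
  have he : ∀ j, 0 < e j := by
    rintro ((⟨a, i⟩ | ⟨a, i⟩) | a)
    · change 0 < d a - 1 - (i : ℕ); have := i.2; omega
    · change 0 < d a - 1 - (i : ℕ); have := i.2; omega
    · exact hd a
  have hg : ∀ j, (g j).IsHomogeneous (e j) := by
    rintro ((⟨a, i⟩ | ⟨a, i⟩) | a)
    · have h := (isBihom_linePoly p (hF a) (Finsupp.single 0 ((i : ℕ) + 1))).1
      rw [Finsupp.degree_single] at h
      change (coeff (Finsupp.single 0 ((i : ℕ) + 1)) (linePoly p (F a))).IsHomogeneous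
        (d a - 1 - (i : ℕ))
      convert h using 1
      omega
    · have h := (isBihom_linePoly q (hF a) (Finsupp.single 0 ((i : ℕ) + 1))).1
      rw [Finsupp.degree_single] at h
      change (coeff (Finsupp.single 0 ((i : ℕ) + 1)) (linePoly q (F a))).IsHomogeneous
        (d a - 1 - (i : ℕ))
      convert h using 1
      omega
    · exact hF a
  have hcount : ∑ j, e j ^ r < Fintype.card (Fin (N + 1)) := by
    rw [Fintype.card_fin]
    refine lt_of_le_of_lt (le_of_eq ?_) hN
    rw [Fintype.sum_sum_type, Fintype.sum_sum_type, Fintype.sum_sigma, Fintype.sum_sigma,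
      ← Finset.sum_add_distrib, ← Finset.sum_add_distrib]
    refine Finset.sum_congr rfl fun a _ => ?_
    change ∑ i : Fin (d a - 1), (d a - 1 - (i : ℕ)) ^ r + ∑ i : Fin (d a - 1), (d a - 1 - (i : ℕ)) ^ r +
      d a ^ r = 2 * ∑ i : Fin (d a - 1), (d a - 1 - (i : ℕ)) ^ r + d a ^ r
    ring
  obtain ⟨rv, hr0, hr⟩ := hK.exists_common_zero g e he hg hcount
  -- verification (verbatim as in `exists_two_line_chain`)
  have hzero : ∀ (w : Fin (N + 1) → K) (hw : ∀ a, eval w (F a) = 0)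
      (hcoef : ∀ a (i : Fin (d a - 1)),
        eval rv (coeff (Finsupp.single 0 ((i : ℕ) + 1)) (linePoly w (F a))) = 0)
      (a : Fin c) (s t : K), eval (s • w + t • rv) (F a) = 0 := by
    intro w hw hcoef a s t
    have hv : ∀ α ∈ (linePoly w (F a)).support, α.degree < d a →
        eval rv (coeff α (linePoly w (F a))) = 0 := by
      intro α _ hα
      rw [finsupp_fin_one_eq_single α]
      rcases Nat.eq_zero_or_pos α.degree with h0 | hpos
      · rw [h0, Finsupp.single_zero, eval_coeff_zero_linePoly]
        exact hr (Sum.inr a)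
      · obtain ⟨m, hm⟩ := Nat.exists_eq_succ_of_ne_zero hpos.ne'
        have hlt : m < d a - 1 := by omega
        rw [hm]
        exact hcoef a ⟨m, hlt⟩
    have key := eval_eval_smul_eq_of_isBihom_of_degree (isBihom_linePoly w (hF a)) hv
      (fun _ => s) t
    rw [eval_eval_linePoly, eval_eval_linePoly, add_zero, eval_smul_of_isHomogeneous (hF a), hw a,
      mul_zero] at key
    exact key
  refine ⟨rv, hr0, fun a s t => ⟨hzero p hp (fun a i => hr (Sum.inl (Sum.inl ⟨a, i⟩))) a s t,
    hzero q hq (fun a i => hr (Sum.inl (Sum.inr ⟨a, i⟩))) a s t⟩⟩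

/-- The count for ONE cubic form and `r = 2`: `2 (2² + 1²) + 3² = 19`. [folklore] -/
theorem two_point_chain_count_cubic_two :
    (∑ _a : Fin 1, (2 * ∑ i : Fin (3 - 1), (3 - 1 - (i : ℕ)) ^ 2 + 3 ^ 2)) = 19 := by
  decide

end Literature.RingTheory.MvPolynomial

end
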